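import Summits.CriticalPhenomena.PercolationContinuityZ3.Theorems.SahiMasterFamilyFiveIdentities

/-!
# The order-five step, positivity half: `E_5 ≥ 0` on every 5-family of increasing events with a `Z_4` sub-family

Unit `prim-master-conj` (crux anchor stmt-CriticalPhenomena-4575).  `SahiMasterFamilyFourStep.lean` proved the order-four
step (both halves) from the sandwich structure of `Z_3`.  Its zero analysis (`supports_of_sahiE_four_eq_zero`) describes
`Z_4`: with `(X, Y, G)` the `Z_3` sub-triple via `(X, Y)`, `K ⊇ G` the forced-open hull and `N = K ∖ G`,
 (a) `K = G` — then `(X, Y, K)` is an independent frame and the fourth event `D` agrees with ITS hull `K_D` on the three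
     pairwise intersections (`inter_inter_hull_subset`), i.e. `N_D = K_D ∖ D` kills the pairwise products; or
 (b) `D` is `Z_3`-sandwiched over `(X, Y)` as well, with hull `K'` independent of `K`.
By multilinearity in the shrunk slots and the annihilator identities (`SahiMasterFamilyAnnihilator.lean`,
`sahiE_five_of_pairwise_annihilator`), for ANY weight (`sahiE_five_eq_of_frame_shrink`, `sahiE_five_eq_of_two_shrinks`):
 (a) `E_5(D,K,W,X,Y) = E_5(K_D,K,W,X,Y) + E(N_D K)E_3(W,X,Y) + E(N_D X)E_3(W,K,Y) + E(N_D Y)E_3(W,K,X) + E(N_D)E_4(K,W,X,Y)`,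
 (b) `E_5(G,D,W,X,Y) = E_5(K,K',W,X,Y) + E(N)E_4(K',W,X,Y) + E(N')E_4(K,W,X,Y) + [E(NK') + E(N'K) + E(N)E(N') − E(NN')]·E_3(W,X,Y)`,
every `E` on the right being an independent-frame functional (`sahiE_ind_nonneg_of_frame`, order-four step, independent
pair), every coefficient nonnegative.  HENCE (`sahiE_five_ind_nonneg_of_zeroFlagQuadruple`): **Sahi's `E_5(μ_p; U) ≥ 0` for
every 5-family of increasing events `U` containing a `Z_4` sub-family, every `p ∈ [0,1]^ι`** — the order-five case of
`MasterFamilyNonneg` on such families, with no order-3/4 conjecture as input.  No conjecture asserted; axioms standard. [this work]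
-/

noncomputable section

open scoped Classical

namespace Summit.CriticalPhenomena.PercolationContinuityZ3.Theorems

open Finset Function MeasureTheory
open Literature.Combinatorics.Sahi2008
open Literature.Probability.Percolation (DeterminedBy)
open Literature.Probability.LatticeModels (prodBernoulli)
open Literature.Probability.LatticeModels.Kahn2022 (Affects)
open Literature.Probability.Percolation.DecisionTree (ind ind_of_mem ind_of_not_mem ind_nonneg)

/-! ### Events: positivity of the pieces -/

section Events

variable {ι : Type} [Fintype ι]

/-- A family with an empty member has `E_k = 0`. [folklore] -/
theorem sahiE_ind_eq_zero_of_eq_empty (p : ι → unitInterval) {k : ℕ} (U : Fin k → Set (Set ι)) (j : Fin k)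
    (hj : U j = ∅) : sahiE (bernoulliWeight p) k (fun l => ind (U l)) = 0 := by
  have : (fun l => ind (U l)) = update (fun l => ind (U l)) j 0 := by
    funext l
    by_cases h : l = j
    · subst h; rw [update_self, hj]; funext ω; exact ind_of_not_mem (Set.notMem_empty ω)
    · rw [update_of_ne h]
  rw [this]; exact sahiE_update_zero _ _ _

/-- Pairwise disjoint essential supports give `Z_3` (vector form). [this work] -/
theorem suppZeroFlag_three_of_disjoint {X Y G : Set (Set ι)} (hX : IsUpperSet X) (hY : IsUpperSet Y)
    (hG : IsUpperSet G) (dXY : Disjoint (esupp X) (esupp Y)) (dXG : Disjoint (esupp X) (esupp G))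
    (dYG : Disjoint (esupp Y) (esupp G)) : SuppZeroFlag 3 ![X, Y, G] := by
  refine suppZeroFlag_three_of_Z ((suppZeroFlag_two_iff hX hY).2 dXY)
    ((suppZeroFlag_two_iff (hX.inter hG) hY).2 ?_) ((suppZeroFlag_two_iff hX (hY.inter hG)).2 ?_)
  · exact Finset.disjoint_of_subset_left (esupp_inter_subset X G) (Finset.disjoint_union_left.2 ⟨dXY, dYG.symm⟩)
  · exact Finset.disjoint_of_subset_right (esupp_inter_subset Y G) (Finset.disjoint_union_right.2 ⟨dXY, dXG⟩)

/-- `E_3(W, X, Y) ≥ 0` for an independent pair `(X, Y)`. [this work] -/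
theorem sahiE_three_vec_nonneg (p : ι → unitInterval) {W X Y : Set (Set ι)} (hW : IsUpperSet W) (hX : IsUpperSet X)
    (hY : IsUpperSet Y) (dXY : Disjoint (esupp X) (esupp Y)) :
    0 ≤ sahiE (bernoulliWeight p) 3 ![ind W, ind X, ind Y] := by
  have hU : ∀ j, IsUpperSet ((![W, X, Y] : Fin 3 → Set (Set ι)) j) := by
    intro j; fin_cases j
    · exact hW
    · exact hX
    · exact hY
  have h := sahiE_three_ind_nonneg_of_indepPair p ![W, X, Y] hU 0 (by
    have e : (fun j => (![W, X, Y] : Fin 3 → Set (Set ι)) ((0 : Fin 3).succAbove j)) = ![X, Y] := by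
      funext j; fin_cases j <;> rfl
    rw [e]; exact (suppZeroFlag_two_iff hX hY).2 dXY)
  have e : (fun j => ind ((![W, X, Y] : Fin 3 → Set (Set ι)) j)) = ![ind W, ind X, ind Y] := by
    funext j; fin_cases j <;> rfl
  rwa [e] at h

/-- `E_4(K, W, X, Y) ≥ 0` for an independent frame `(K, X, Y)` (the order-four step). [this work] -/
theorem sahiE_four_vec_nonneg (p : ι → unitInterval) {K W X Y : Set (Set ι)} (hK : IsUpperSet K) (hW : IsUpperSet W)
    (hX : IsUpperSet X) (hY : IsUpperSet Y) (dXY : Disjoint (esupp X) (esupp Y)) (dKX : Disjoint (esupp K) (esupp X))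
    (dKY : Disjoint (esupp K) (esupp Y)) : 0 ≤ sahiE (bernoulliWeight p) 4 ![ind K, ind W, ind X, ind Y] := by
  have hU : ∀ j, IsUpperSet ((![K, W, X, Y] : Fin 4 → Set (Set ι)) j) := by
    intro j; fin_cases j
    · exact hK
    · exact hW
    · exact hX
    · exact hY
  have h := sahiE_four_ind_nonneg_of_zeroFlagTriple p ![K, W, X, Y] hU 1 (by
    have e : (fun j => (![K, W, X, Y] : Fin 4 → Set (Set ι)) ((1 : Fin 4).succAbove j)) = ![K, X, Y] := by
      funext j; fin_cases j <;> rfl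
    rw [e]; exact suppZeroFlag_three_of_disjoint hK hX hY dKX dKY dXY)
  have e : (fun j => ind ((![K, W, X, Y] : Fin 4 → Set (Set ι)) j)) = ![ind K, ind W, ind X, ind Y] := by
    funext j; fin_cases j <;> rfl
  rwa [e] at h

/-- `E_5(A, B, W, X, Y) ≥ 0` for an independent frame `(A, B, X, Y)` (`sahiE_ind_nonneg_of_frame`). [this work] -/
theorem sahiE_five_vec_nonneg (p : ι → unitInterval) {A B W X Y : Set (Set ι)} (hA : IsUpperSet A) (hB : IsUpperSet B)
    (hW : IsUpperSet W) (hX : IsUpperSet X) (hY : IsUpperSet Y) (dAB : Disjoint (esupp A) (esupp B))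
    (dAX : Disjoint (esupp A) (esupp X)) (dAY : Disjoint (esupp A) (esupp Y)) (dBX : Disjoint (esupp B) (esupp X))
    (dBY : Disjoint (esupp B) (esupp Y)) (dXY : Disjoint (esupp X) (esupp Y)) :
    0 ≤ sahiE (bernoulliWeight p) 5 ![ind A, ind B, ind W, ind X, ind Y] := by
  have hU : ∀ j, IsUpperSet ((![A, B, W, X, Y] : Fin 5 → Set (Set ι)) j) := by
    intro j; fin_cases j
    · exact hA
    · exact hB
    · exact hW
    · exact hX
    · exact hY
  have h := sahiE_ind_nonneg_of_frame p ![A, B, W, X, Y] hU 2 (by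
    intro j j' hj hj' hne
    fin_cases j <;> fin_cases j' <;>
      first
      | exact absurd rfl hne
      | exact absurd rfl hj
      | exact absurd rfl hj'
      | exact dAB | exact dAB.symm | exact dAX | exact dAX.symm | exact dAY | exact dAY.symm
      | exact dBX | exact dBX.symm | exact dBY | exact dBY.symm | exact dXY | exact dXY.symm)
  have e : (fun j => ind ((![A, B, W, X, Y] : Fin 5 → Set (Set ι)) j)) = ![ind A, ind B, ind W, ind X, ind Y] := by
    funext j; fin_cases j <;> rfl
  rwa [e] at h

omit [Fintype ι] in
/-- `1_A · 1_B · 1_{C ∖ D} = 0` when `A ∩ B ∩ C ⊆ D`. [folklore] -/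
theorem ind_mul_ind_mul_ind_diff_eq_zero {A B C D : Set (Set ι)} (h : A ∩ B ∩ C ⊆ D) :
    ind A * ind B * ind (C \ D) = 0 := by
  funext ω
  simp only [Pi.mul_apply, Pi.zero_apply]
  by_cases hA : ω ∈ A
  · by_cases hB : ω ∈ B
    · by_cases hC : ω ∈ C \ D
      · exact absurd (h ⟨⟨hA, hB⟩, hC.1⟩) hC.2
      · rw [ind_of_not_mem hC, mul_zero]
    · rw [ind_of_not_mem hB, mul_zero, zero_mul]
  · rw [ind_of_not_mem hA, zero_mul, zero_mul]

/-- Expectations of products of indicators are nonnegative. [folklore] -/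
theorem ex_ind_mul_nonneg (p : ι → unitInterval) (A B : Set (Set ι)) : 0 ≤ ex (bernoulliWeight p) (ind A * ind B) :=
  ex_nonneg (isFKGMeasure_bernoulliWeight p).nonneg fun _ => mul_nonneg (ind_nonneg _ _) (ind_nonneg _ _)

/-- Expectations of indicators are nonnegative. [folklore] -/
theorem ex_ind_nonneg' (p : ι → unitInterval) (A : Set (Set ι)) : 0 ≤ ex (bernoulliWeight p) (ind A) :=
  ex_nonneg (isFKGMeasure_bernoulliWeight p).nonneg fun _ => ind_nonneg _ _

/-- `E(1_N 1_{N'}) ≤ E(1_{K'} 1_N)` when `N' ⊆ K'`. [folklore] -/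
theorem ex_ind_mul_le_of_subset (p : ι → unitInterval) {N N' K' : Set (Set ι)} (h : N' ⊆ K') :
    ex (bernoulliWeight p) (ind N * ind N') ≤ ex (bernoulliWeight p) (ind K' * ind N) := by
  refine ex_mono (isFKGMeasure_bernoulliWeight p).nonneg fun ω => ?_
  simp only [Pi.mul_apply]
  rw [mul_comm (ind K' ω)]
  refine mul_le_mul_of_nonneg_left ?_ (ind_nonneg _ _)
  by_cases hω : ω ∈ N'
  · rw [ind_of_mem hω, ind_of_mem (h hω)]
  · rw [ind_of_not_mem hω]; exact ind_nonneg _ _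

/-! ### The theorem -/

set_option maxHeartbeats 1600000 in -- one long assembly: five named slots, two structural cases
/-- **Sahi's `E_5 ≥ 0` on every 5-family of increasing events with a `Z_4` sub-family** (every `p ∈ [0,1]^ι`): if the four
events other than `U_m` form a zero flag of order `4` then `0 ≤ E_5(μ_p; 1_{U_0},…,1_{U_4})` — the order-five case of
`MasterFamilyNonneg` on such families, from the structure of `Z_4` (order-four step), multilinearity, the annihilator
identities and the independent-frame positivity; no conjecture of lower order is used. [this work] -/
theorem sahiE_five_ind_nonneg_of_zeroFlagQuadruple (p : ι → unitInterval) (U : Fin 5 → Set (Set ι))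
    (hU : ∀ j, IsUpperSet (U j)) (m : Fin 5) (hZ : SuppZeroFlag 4 (fun j => U (m.succAbove j))) :
    0 ≤ sahiE (bernoulliWeight p) 5 (fun j => ind (U j)) := by
  have hZ4 := hZ
  obtain ⟨i, hZ3, -⟩ := hZ
  obtain ⟨i', h1, h2, h3⟩ := (suppZeroFlag_three_iff_exists _).1 hZ3
  set W := U m with hWdef
  set D := U (m.succAbove i) with hDdef
  set G := U (m.succAbove (i.succAbove i')) with hGdef
  set X := U (m.succAbove (i.succAbove (i'.succAbove 0))) with hXdef
  set Y := U (m.succAbove (i.succAbove (i'.succAbove 1))) with hYdef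
  have hW : IsUpperSet W := hU _; have hD : IsUpperSet D := hU _; have hG : IsUpperSet G := hU _
  have hX : IsUpperSet X := hU _; have hY : IsUpperSet Y := hU _
  -- degenerate members
  rcases Set.eq_empty_or_nonempty X with hX0 | hXne
  · exact (sahiE_ind_eq_zero_of_eq_empty p U _ hX0).symm.le
  rcases Set.eq_empty_or_nonempty Y with hY0 | hYne
  · exact (sahiE_ind_eq_zero_of_eq_empty p U _ hY0).symm.le
  rcases Set.eq_empty_or_nonempty G with hG0 | hGne
  · exact (sahiE_ind_eq_zero_of_eq_empty p U _ hG0).symm.le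
  rw [sahiE_five_reindex _ _ m i i']
  show 0 ≤ sahiE (bernoulliWeight p) 5 ![ind G, ind D, ind W, ind X, ind Y]
  -- the `Z_4` structure, read off at the centre of the cube
  have hZV : ZVia X Y G := ⟨h1, h2, h3⟩
  set K : Set (Set ι) := {ω : Set ι | ω ∪ ↑(esupp X ∪ esupp Y) ∈ G} with hK
  have e4 : sahiE (bernoulliWeight (halfParams ι)) 4 ![ind G, ind D, ind X, ind Y] = 0 := by
    have z := sahiE_ind_eq_zero_of_suppZeroFlag (halfParams ι) hZ4
    rwa [sahiE_four_reindex _ _ i i'] at z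
  obtain ⟨F1, F2, F3, F4⟩ :=
    supports_of_sahiE_four_eq_zero (halfParams ι) (halfParams_mem_Ioo ι) hX hY hG hD hXne hYne hZV K hK e4
  have hKu : IsUpperSet K := isUpperSet_forcedHull hG _
  have hGK : G ⊆ K := subset_forcedHull hG _
  have hKne : K.Nonempty := hGne.mono hGK
  have hXG : X ∩ G = X ∩ K := sandwich_left hX hY hG hYne hZV
  have hYG : Y ∩ G = Y ∩ K := sandwich_right hX hY hG hXne hZV
  have dXY : Disjoint (esupp X) (esupp Y) := (suppZeroFlag_two_iff hX hY).1 h1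
  have dXK : Disjoint (esupp X) (esupp K) := Finset.disjoint_left.2 fun e heX heK =>
    forall_not_affects_forcedHull_left X Y G e (mem_esupp.1 heX) (mem_esupp.1 heK)
  have dYK : Disjoint (esupp Y) (esupp K) := Finset.disjoint_left.2 fun e heY heK =>
    forall_not_affects_forcedHull_right X Y G e (mem_esupp.1 heY) (mem_esupp.1 heK)
  have dXN : Disjoint X (K \ G) := Set.disjoint_left.2 fun ω hωX hωN =>
    hωN.2 ((Set.ext_iff.1 hXG ω).2 ⟨hωX, hωN.1⟩).2
  have dYN : Disjoint Y (K \ G) := Set.disjoint_left.2 fun ω hωY hωN =>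
    hωN.2 ((Set.ext_iff.1 hYG ω).2 ⟨hωY, hωN.1⟩).2
  have e2XY : sahiE (bernoulliWeight p) 2 ![ind X, ind Y] = 0 :=
    sahiE_ind_eq_zero_of_suppZeroFlag p (U := ![X, Y]) h1
  have e3K : sahiE (bernoulliWeight p) 3 ![ind K, ind X, ind Y] = 0 :=
    sahiE_ind_eq_zero_of_suppZeroFlag p (U := ![K, X, Y]) (suppZeroFlag_three_of_disjoint hKu hX hY dXK.symm dYK.symm dXY)
  have e3W : 0 ≤ sahiE (bernoulliWeight p) 3 ![ind W, ind X, ind Y] := sahiE_three_vec_nonneg p hW hX hY dXY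
  have e4K : 0 ≤ sahiE (bernoulliWeight p) 4 ![ind K, ind W, ind X, ind Y] :=
    sahiE_four_vec_nonneg p hKu hW hX hY dXY dXK.symm dYK.symm
  rcases F4 with hKG | ⟨F5, F6⟩
  · -- case (a): `G = K` is a frame member; shrink `D` from its hull `K_D` over the frame supports
    rw [sahiE_five_swap01, ← hKG]
    rw [← hKG] at F1 F2
    set KD : Set (Set ι) := {ω : Set ι | ω ∪ ↑(esupp X ∪ esupp Y ∪ esupp K) ∈ D} with hKD
    have hKDu : IsUpperSet KD := isUpperSet_forcedHull hD _
    have hDKD : D ⊆ KD := subset_forcedHull hD _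
    obtain ⟨sXK, sYK, sXY⟩ := inter_inter_hull_subset hX hY hKu hD hXne hYne hKne F1 F2 F3
    have nKD : ∀ {Z : Set (Set ι)} {e : ι}, Affects Z e → e ∈ esupp X ∪ esupp Y ∪ esupp K → ¬ Affects KD e :=
      fun _ he hK' => not_affects_forcedHull D (mem_coe.2 he) hK'
    have dKDX : Disjoint (esupp KD) (esupp X) := Finset.disjoint_left.2 fun e heKD heX =>
      nKD (mem_esupp.1 heX) (by simp [heX]) (mem_esupp.1 heKD)
    have dKDY : Disjoint (esupp KD) (esupp Y) := Finset.disjoint_left.2 fun e heKD heY =>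
      nKD (mem_esupp.1 heY) (by simp [heY]) (mem_esupp.1 heKD)
    have dKDK : Disjoint (esupp KD) (esupp K) := Finset.disjoint_left.2 fun e heKD heK =>
      nKD (mem_esupp.1 heK) (by simp [heK]) (mem_esupp.1 heKD)
    have e2KX : sahiE (bernoulliWeight p) 2 ![ind K, ind X] = 0 :=
      sahiE_ind_eq_zero_of_suppZeroFlag p (U := ![K, X]) ((suppZeroFlag_two_iff hKu hX).2 dXK.symm)
    have e2KY : sahiE (bernoulliWeight p) 2 ![ind K, ind Y] = 0 :=
      sahiE_ind_eq_zero_of_suppZeroFlag p (U := ![K, Y]) ((suppZeroFlag_two_iff hKu hY).2 dYK.symm)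
    rw [sahiE_five_eq_of_frame_shrink (bernoulliWeight p) (ind D) (ind K) (ind W) (ind X) (ind Y) (ind KD)
      (ind (KD \ D)) (by rw [ind_diff_eq_sub hDKD]; ring)
      (by rw [mul_comm (ind K)]; exact ind_mul_ind_mul_ind_diff_eq_zero sXK)
      (by rw [mul_comm (ind K)]; exact ind_mul_ind_mul_ind_diff_eq_zero sYK)
      (ind_mul_ind_mul_ind_diff_eq_zero sXY) e2XY e2KX e2KY e3K]
    have t1 := sahiE_five_vec_nonneg p hKDu hKu hW hX hY dKDK dKDX dKDY dXK.symm dYK.symm dXY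
    have t3 : 0 ≤ sahiE (bernoulliWeight p) 3 ![ind W, ind K, ind Y] := sahiE_three_vec_nonneg p hW hKu hY dYK.symm
    have t4 : 0 ≤ sahiE (bernoulliWeight p) 3 ![ind W, ind K, ind X] := sahiE_three_vec_nonneg p hW hKu hX dXK.symm
    have c2 := ex_ind_mul_nonneg p K (KD \ D)
    have c3 := ex_ind_mul_nonneg p X (KD \ D)
    have c4 := ex_ind_mul_nonneg p Y (KD \ D)
    have c5 := ex_ind_nonneg' p (KD \ D)
    have := mul_nonneg c2 e3W; have := mul_nonneg c3 t3; have := mul_nonneg c4 t4; have := mul_nonneg c5 e4K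
    linarith
  · -- case (b): `D` is sandwiched over `(X, Y)` too, with hull `K'` independent of `K`
    have hZD : ZVia X Y D := ⟨h1, (suppZeroFlag_two_iff (hX.inter hD) hY).2 F5, (suppZeroFlag_two_iff hX (hY.inter hD)).2 F6⟩
    set K' : Set (Set ι) := {ω : Set ι | ω ∪ ↑(esupp X ∪ esupp Y) ∈ D} with hK'
    have hK'u : IsUpperSet K' := isUpperSet_forcedHull hD _
    have hDK' : D ⊆ K' := subset_forcedHull hD _
    have hXD : X ∩ D = X ∩ K' := sandwich_left hX hY hD hYne hZD
    have hYD : Y ∩ D = Y ∩ K' := sandwich_right hX hY hD hXne hZD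
    have dXK' : Disjoint (esupp X) (esupp K') := Finset.disjoint_left.2 fun e heX heK =>
      forall_not_affects_forcedHull_left X Y D e (mem_esupp.1 heX) (mem_esupp.1 heK)
    have dYK' : Disjoint (esupp Y) (esupp K') := Finset.disjoint_left.2 fun e heY heK =>
      forall_not_affects_forcedHull_right X Y D e (mem_esupp.1 heY) (mem_esupp.1 heK)
    have dXN' : Disjoint X (K' \ D) := Set.disjoint_left.2 fun ω hωX hωN =>
      hωN.2 ((Set.ext_iff.1 hXD ω).2 ⟨hωX, hωN.1⟩).2
    have dYN' : Disjoint Y (K' \ D) := Set.disjoint_left.2 fun ω hωY hωN =>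
      hωN.2 ((Set.ext_iff.1 hYD ω).2 ⟨hωY, hωN.1⟩).2
    -- `K ⟂ K'`: the coordinates of `K'` act on `X ∩ Y ∩ D = (X ∩ Y) ∩ K'`
    have dKK' : Disjoint (esupp K) (esupp K') := by
      have hsub : esupp K' ⊆ esupp (K' ∩ (X ∩ Y)) :=
        esupp_subset_esupp_inter hK'u (hX.inter hY) ⟨Set.univ, univ_mem_of_nonempty hX hXne, univ_mem_of_nonempty hY hYne⟩
          (Finset.disjoint_of_subset_right (esupp_inter_subset X Y) (Finset.disjoint_union_right.2 ⟨dXK'.symm, dYK'.symm⟩))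
      have heq : K' ∩ (X ∩ Y) = X ∩ Y ∩ D := by
        ext ω; constructor
        · rintro ⟨hK', hXω, hYω⟩
          exact ⟨⟨hXω, hYω⟩, ((Set.ext_iff.1 hXD ω).2 ⟨hXω, hK'⟩).2⟩
        · rintro ⟨⟨hXω, hYω⟩, hDω⟩
          exact ⟨hDK' hDω, hXω, hYω⟩
      rw [heq] at hsub
      exact Finset.disjoint_of_subset_right hsub F3
    have e3K' : sahiE (bernoulliWeight p) 3 ![ind K', ind X, ind Y] = 0 :=
      sahiE_ind_eq_zero_of_suppZeroFlag p (U := ![K', X, Y])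
        (suppZeroFlag_three_of_disjoint hK'u hX hY dXK'.symm dYK'.symm dXY)
    rw [sahiE_five_eq_of_two_shrinks (bernoulliWeight p) (ind G) (ind D) (ind W) (ind X) (ind Y) (ind K) (ind K')
      (ind (K \ G)) (ind (K' \ D)) (by rw [ind_diff_eq_sub hGK]; ring) (by rw [ind_diff_eq_sub hDK']; ring)
      (ind_mul_ind_eq_zero_of_disjoint dXN) (ind_mul_ind_eq_zero_of_disjoint dYN)
      (ind_mul_ind_eq_zero_of_disjoint dXN') (ind_mul_ind_eq_zero_of_disjoint dYN') e2XY e3K e3K']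
    have t1 := sahiE_five_vec_nonneg p hKu hK'u hW hX hY dKK' dXK.symm dYK.symm dXK'.symm dYK'.symm dXY
    have t2 : 0 ≤ sahiE (bernoulliWeight p) 4 ![ind K', ind W, ind X, ind Y] :=
      sahiE_four_vec_nonneg p hK'u hW hX hY dXY dXK'.symm dYK'.symm
    have cN := ex_ind_nonneg' p (K \ G)
    have cN' := ex_ind_nonneg' p (K' \ D)
    have cKN' := ex_ind_mul_nonneg p K (K' \ D)
    have cmono := ex_ind_mul_le_of_subset p (N := K \ G) (N' := K' \ D) (K' := K') Set.sdiff_subset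
    have hb : 0 ≤ ex (bernoulliWeight p) (ind K' * ind (K \ G)) + ex (bernoulliWeight p) (ind K * ind (K' \ D))
        + ex (bernoulliWeight p) (ind (K \ G)) * ex (bernoulliWeight p) (ind (K' \ D))
        - ex (bernoulliWeight p) (ind (K \ G) * ind (K' \ D)) := by
      have := mul_nonneg cN cN'; linarith
    have := mul_nonneg cN t2; have := mul_nonneg cN' e4K; have := mul_nonneg hb e3W
    linarith

end Events


end Summit.CriticalPhenomena.PercolationContinuityZ3.Theorems
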